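import Summits.QuantumFields.YangMills.Theorems.VirialFluxGapAnchoredProfile
import Summits.QuantumFields.YangMills.Theorems.VirialFluxGapResolventFieldStep
import Summits.QuantumFields.YangMills.Theorems.VirialFluxGapFixFrameStd
import HarnessLib

/-!
# Route `VirialFluxGap` (YangMills): the EXPLICIT CENTRAL FIELD `X_c = X_z + U` — definitions of the direction assignment and of the coefficient family `c²`
# in the standard `X_fix` frame (central chart C1 of crux ⟨stmt-QuantumFields-24141⟩ `PeriodicSoftness`; definitions file, free-hands)

Width seat `ym-line-sfw-p2-w3` g59 (cell ym-idea-1, free hands; own crux ⟨22884⟩ has no free stub), `--supports stmt-QuantumFields-24141`.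

LEAD ruling (A), 2026-08-31T02:02Z (ym-idea-1 bus): the central piece of the ⟨24141⟩ Euler field is the EXPLICIT field of HOME memo
`w3-g59-EXPLICIT-CENTRAL-FIELD-24141.md` — at every ring variable `w` the direction `quatMatrix(Im(conj(c_w)·q_w) + ½σ_B z_B)` where `q_w` is the variable's
quaternion, `z_B` the block average of `Im q` over the wrap block ∕ seam containing `w` (`0` and anchor `c_w = 1` for the other variables), and
`c_w = liftQuat σ_B z_B` the slot of the central projection `π_C` (✓`centralRep`).  This file writes that field as smooth functions OF THE AMBIENT COORDINATES
`M` (the letters of ✓`periodicSoftness_of_smoothFrameField_inline` and of ✓`FieldPatching`), with ONE deviation that changes nothing on the central region: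
the real part `σ√(1−|z|²)` of the lift is replaced by the CLAMPED `σ√(1 − |z|²·ψ(|z|²))` (`ψ` = ✓`deficitStep`: `= 1` on `[0,½]`, `= 0` on `[1,∞)`), which equals
it for `|z|² ≤ ½` and is smooth for ALL `z` (the radicand is `≥ ½·…`, see the theorems file) — so the coefficients are globally `C^∞` with no support condition.

Definitions (all `noncomputable`, no theorem, no `sorry`):
* `readQuat X` — the first row of a `2×2` complex matrix as a quaternion (`= su2Quat U` on `SU(2)`, cf. ✓`exists_firstRow_clm`);
* `imVec q` — the imaginary part of a quaternion as a vector `Fin 3 → ℝ`;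
* `blockAvgM L k M`, `seamAvgM L M` — the wrap-block ∕ seam averages of `Im readQuat` read off the coordinates (`= blockIm (wrapBlock k) k P`, `seamIm P` at
  `M = ringCoord P`);
* `clampRe σ z`, `clampLift σ z` — the clamped central lift `(σ√(1 − |z|²ψ(|z|²)), z)`;
* `anchoredIm c X` — `Im(conj(c)·readQuat X)` as a vector (the anchored radial profile of ✓`VirialFluxGapAnchoredProfile`, weight `1`);
* ★ `centralDir L σ σ₄ M` — the direction assignment of `X_c` at the coordinates `M` (signs `σ : Fin 3 → ℝ`, `σ₄ : ℝ`; `0` on the slice-`0` comb tree);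
* ★ `centralCoeff L σ σ₄ va M := fixCoord (centralDir L σ σ₄ M) va` — the coefficient family `c²_va`, `va : FixVar L × Fin 3`, in w2's ✓`fixFrameStd`.
With w2's smooth sign selectors (⧗`CentralSignSelector.linkSign ∕ seamSign`) substituted for `σ, σ₄` this is ONE global smooth family.

HONEST LABEL: definitions only; smoothness, the identification with `X_z + U` at ring histories, the drive and the divergence are the theorems files; the central
piece is NOT assembled; ⟨24141⟩ and ⟨22884⟩ stay OPEN; the Yang–Mills mass gap is NOT proved by this; no summit is proved by a line.

References: [cite: CosteEtAl1985] (zero-mode quartic ∕ central torons); [cite: Luscher1983, §2]; [cite: arXiv220412737, §2 (2.4) (p. 10)] (radial profiles).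
-/

set_option autoImplicit false

noncomputable section

open scoped Matrix BigOperators Quaternion
open Literature.MathematicalPhysics.QuantumFieldTheory hiding SU2
open Literature.MathematicalPhysics.QuantumLattice

namespace Summit.QuantumFields.YangMills.Theorems.VirialFluxGap.CentralField

open Summit.QuantumFields.YangMills.Theorems.FemtoTransferGap
open Summit.QuantumFields.YangMills.Theorems.VirialFluxGap.FrameDerivative
open Summit.QuantumFields.YangMills.Theorems.VirialFluxGap.FrameHessian
open Summit.QuantumFields.YangMills.Theorems.VirialFluxGap.FixFrame

variable {L : ℕ} [NeZero L]

/-! ## §1 Quaternion letters on the ambient coordinates -/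

omit [NeZero L] in
/-- The first row of a `2×2` complex matrix as a quaternion: `re X₀₀ + im X₀₀·i + re X₀₁·j + im X₀₁·k` (`= su2Quat U` for `U ∈ SU(2)`). [folklore] -/
def readQuat (X : Matrix (Fin 2) (Fin 2) ℂ) : ℍ := ⟨(X 0 0).re, (X 0 0).im, (X 0 1).re, (X 0 1).im⟩

omit [NeZero L] in
/-- The imaginary part of a quaternion as a vector of `ℝ³`. [folklore] -/
def imVec (q : ℍ) : Fin 3 → ℝ := ![q.imI, q.imJ, q.imK]

/-- The wrap-block average of `Im q` over the wrap block of direction `k` (all slices, sites with `x_k = −1`), read off the coordinates. [cite: CosteEtAl1985] -/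
def blockAvgM (L : ℕ) [NeZero L] (k : Fin 3)
    (M : (Fin (2 * L - 1 + 1) → Edge 3 L → Matrix (Fin 2) (Fin 2) ℂ) × (Site 3 L → Matrix (Fin 2) (Fin 2) ℂ)) : Fin 3 → ℝ :=
  fun a => (∑ v ∈ wrapBlock L k, imVec (readQuat (M.1 v.1 (v.2, k))) a) / ((wrapBlock L k).card : ℝ)

/-- The seam average of `Im q`, read off the coordinates. [cite: CosteEtAl1985] -/
def seamAvgM (L : ℕ) [NeZero L]
    (M : (Fin (2 * L - 1 + 1) → Edge 3 L → Matrix (Fin 2) (Fin 2) ℂ) × (Site 3 L → Matrix (Fin 2) (Fin 2) ℂ)) : Fin 3 → ℝ :=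
  fun a => (∑ x : Site 3 L, imVec (readQuat (M.2 x)) a) / ((L : ℝ) ^ 3)

/-! ## §2 The clamped central lift -/

omit [NeZero L] in
/-- The CLAMPED real part of the central lift: `σ·√(1 − |z|²·ψ(|z|²))`, `ψ` = ✓`deficitStep` — equal to `σ√(1−|z|²)` for `|z|² ≤ ½`, smooth for all `z`.
[folklore] -/
def clampRe (σ : ℝ) (z : Fin 3 → ℝ) : ℝ :=
  σ * Real.sqrt (1 - ((z 0) ^ 2 + (z 1) ^ 2 + (z 2) ^ 2) * deficitStep ((z 0) ^ 2 + (z 1) ^ 2 + (z 2) ^ 2))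

omit [NeZero L] in
/-- The CLAMPED CENTRAL LIFT `(σ√(1 − |z|²ψ(|z|²)), z)` — `= liftQuat σ z` (✓) for `|z|² ≤ ½`. [cite: CosteEtAl1985] -/
def clampLift (σ : ℝ) (z : Fin 3 → ℝ) : ℍ := ⟨clampRe σ z, z 0, z 1, z 2⟩

omit [NeZero L] in
/-- The ANCHORED radial profile of a slot as a vector: `Im(conj(c)·readQuat X)` (weight `1`; for `c = 1` the radial profile `Im q`). [cite: arXiv220412737, §2 (2.4) (p. 10)] -/
def anchoredIm (c : ℍ) (X : Matrix (Fin 2) (Fin 2) ℂ) : Fin 3 → ℝ := imVec (star c * readQuat X)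

/-! ## §3 The central field -/

/-- ★ **The direction assignment of the explicit central field `X_c = X_z + U`** at the coordinates `M`, with signs `σ` (wrap blocks) and `σ₄` (seam):
at a wrap-block variable `(i,(x,k))`, `x_k = −1`: `quatMatrix(0, Im(conj(clampLift σ_k z_k)·q) + ½σ_k z_k)`, `z_k = blockAvgM k M`; at a seam variable:
the same with `σ₄`, `z₄ = seamAvgM M`; at the other variables of `X_fix`: the plain radial profile `quatMatrix(0, Im q)`; `0` on the slice-`0` comb tree.
[cite: CosteEtAl1985] -/
def centralDir (L : ℕ) [NeZero L] (σ : Fin 3 → ℝ) (σ₄ : ℝ)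
    (M : (Fin (2 * L - 1 + 1) → Edge 3 L → Matrix (Fin 2) (Fin 2) ℂ) × (Site 3 L → Matrix (Fin 2) (Fin 2) ℂ)) :
    ((Fin (2 * L - 1 + 1) × Edge 3 L) ⊕ Site 3 L) → Matrix (Fin 2) (Fin 2) ℂ
  | Sum.inl (i, e) =>
      if i = 0 ∧ treeEdge e = true then 0
      else if e.1 e.2 = -1 then
        quatMatrix ⟨0,
          anchoredIm (clampLift (σ e.2) (blockAvgM L e.2 M)) (M.1 i e) 0 + (1 / 2 : ℝ) * σ e.2 * blockAvgM L e.2 M 0,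
          anchoredIm (clampLift (σ e.2) (blockAvgM L e.2 M)) (M.1 i e) 1 + (1 / 2 : ℝ) * σ e.2 * blockAvgM L e.2 M 1,
          anchoredIm (clampLift (σ e.2) (blockAvgM L e.2 M)) (M.1 i e) 2 + (1 / 2 : ℝ) * σ e.2 * blockAvgM L e.2 M 2⟩
      else quatMatrix ⟨0, anchoredIm 1 (M.1 i e) 0, anchoredIm 1 (M.1 i e) 1, anchoredIm 1 (M.1 i e) 2⟩
  | Sum.inr x =>
      quatMatrix ⟨0,
        anchoredIm (clampLift σ₄ (seamAvgM L M)) (M.2 x) 0 + (1 / 2 : ℝ) * σ₄ * seamAvgM L M 0,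
        anchoredIm (clampLift σ₄ (seamAvgM L M)) (M.2 x) 1 + (1 / 2 : ℝ) * σ₄ * seamAvgM L M 1,
        anchoredIm (clampLift σ₄ (seamAvgM L M)) (M.2 x) 2 + (1 / 2 : ℝ) * σ₄ * seamAvgM L M 2⟩

/-- ★ **The central coefficient family `c²`** in the standard `X_fix` frame: the half-Pauli coordinates of the central direction assignment,
`centralCoeff σ σ₄ va M = fixCoord (centralDir σ σ₄ M) va` (so that `dirOf fixFrameStd (centralCoeff σ σ₄ · M) = centralDir σ σ₄ M`, ✓`dirOf_fixFrameStd_fixCoord`).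
[cite: CosteEtAl1985] -/
def centralCoeff (L : ℕ) [NeZero L] (σ : Fin 3 → ℝ) (σ₄ : ℝ) (va : FixVar L × Fin 3)
    (M : (Fin (2 * L - 1 + 1) → Edge 3 L → Matrix (Fin 2) (Fin 2) ℂ) × (Site 3 L → Matrix (Fin 2) (Fin 2) ℂ)) : ℝ :=
  fixCoord (centralDir L σ σ₄ M) va

end Summit.QuantumFields.YangMills.Theorems.VirialFluxGap.CentralField

end
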